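import Summits.QuantumFields.YangMills.Theorems.BalabanUVNodesN15FullPropagatorSizedN15At
import Summits.QuantumFields.YangMills.Theorems.BalabanUVNodesN15AtReadingOfRecord13CoPH

/-!
# Route «BalabanUVNodes», cluster K4 «SpineRates» — node N15 = NE2, -a lane, part 83 (programme S, file S-B): THE SIZED (GUARD-LIVE) GENUINE FAMILY AS N15's
# `NE2Objects₁₁` LITERAL — the three `Live` clauses as theorems, the keyed-home faces and the Stage-13 v1.7 `CoPH` faces

Cell `pub-ymgap`, seat `pub-ymgap-dag-n15-a` (-a KNIT-BY-NAME seat of node N15; HUMAN RULING D-0062; chair R424 venue), generation 18, part 83 (ONE data `def` — an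
`NE2Objects₁₁` literal —, the rest theorems; 0 `sorry`).  `bears_on: R4∕N15 · K3⁷ SpineGivenEndpointR13SepCoPH (stmt-QuantumFields-20544)`.  Filed `--kind proof --supports
stmt-QuantumFields-20544 --as helper` — COUNT-NEUTRAL.  Imports part 82 (S-A `…N15FullPropagatorSizedN15At`: `TGIndexS`, `tgInstanceS`, `tgFamilyS`, `genuineSiteStepS`,
`tgCovStepS`, `n15At_fullG_sized`, `tgIndexS_cofinal`) and part 75 `…N15AtReadingOfRecord13CoPH` (the N15 faces at dag-n22-e's `RRec₁₃CoPH` ∕ `RRec₁₃CoPHOn` ∕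
`readingOfRecord₁₃CoPH w1 ℓ₃ ne2 ne1`); nothing in the tree is modified.  PATTERN = parts 76 §4–§5 + 77 (the window-free genuine family `fullGCovObjects`) with the sized family.

WHY.  The K3⁷ v2 pin list (plan g78, START-LIST v4 §2 (q2)) keys N15's slot on a NAMED `ne2` reading that must PASS dag-n15-w2's guard `PairedFamilyGuard.KeyedLive` (cofinal
`gf.M` ∧ `gc.k`, trivial configuration regular, regions inhabited) AND carry `N15At`; the only positive control so far is this seat's g0 LG-vector KNIT family (pieces `H_k`,
`Δ_k`, `C^{(k)}` — w2's `exists_reading_keyedLive_n15At`).  Part 82 made the GENUINE family (Bałaban's full `U ≡ 1` Landau-gauge pair through all four (3.42) entries, his site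
form `(Q′G′²Q′*)⁻¹`, his (2.156) covariance) size-live; this file packages it as RR-1's `NE2Objects₁₁` literal with the three `Live` clauses PROVED AS THEOREMS (§1: `cofinal_…`,
`reg_one_…`, `inΛ_nonempty_…` — w2's structure fields verbatim, so that the `Live` certificate is a three-line application the hour w2's file has an olean; companion S-C) and
supplies the keyed-home and CoPH producer faces the K3⁷ composers (dag-n27-c leaves, n22-e homes) read BY NAME.

WHAT.  §1 def `fullGSizedObjects d hL b a_S ν μ α β c₃₅ p : NE2Objects₁₁`, `ne2OfRecord₁₁_fullGSizedObjects` (rfl), ★★ `n15At_fullGSizedObjects` (OUTRIGHT), `layers_…`,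
`populated_…`, ★ `cofinal_fullGSizedObjects` ∕ `reg_one_fullGSizedObjects` ∕ `inΛ_nonempty_fullGSizedObjects` (the three `Live` clauses); §2 keyed-home faces (part 30's
stage-generic interface): `s_N15_of_admits_fullGSized`, ★★ `s_N15_of_admits_fullGSized_family` (the reading reads the datum's own family: `tgInstanceS 3 F.hL`),
`n15At_fullGSizedObjects_family`, `populated_fullGSizedObjects_family`, `cofinal_fullGSizedObjects_family`; §3 (ns `…N15.AtReadingOfRecord13CoPH`) the v1.7 `CoPH` faces:
`s_N15_rRec₁₃CoPH(On)_of_fullGSizedReading`, ★★ `exists_reading_s_N15_rRec₁₃CoPH_fullGSized_family` (SOME Stage-13 reading — the sized genuine objects on each family's own tori,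
POPULATED and COFINAL at every tuple — has the stub at BOTH homes outright), ★★ `s_N15_readingOfRecord₁₃CoPH_homes_of_fullGSized_family`, `…CoPH∕CoPHOn_of_…`,
`populated_readingOfRecord₁₃CoPH_of_fullGSized_family` (the family-free `∃ ne2` face is part 77's verbatim — cited, not re-filed).

HONEST FRAMING.  Kernel composition BY NAME of part 82 and parts 30∕74∕74b∕75; no estimate in this file.  The family is the `U ≡ 1` (A = 0) content of node N15 for Bałaban's
OWN linear objects on the L-divisible tori of record, size guard LIVE, one-point background carrier (the «+» blocks inert); NOT Bałaban's `G(U)` ∕ `C^{(k)}(Λ)(U)` with the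
background live (NE2⁺ NOT PRINTED beyond King's scalar template), NOT Node 00's [B9] operator layer of record (the pin of `𝔯.lit·ne2` remains the definers' ∕ the plan's) — so
**N15 is NOT discharged** (typed 28∕28 · discharged 5∕27 of record unchanged); count-neutral; one finite four-torus programme at fixed `ε` — NOT ℝ⁴, NOT infinite volume, NOT OS,
NOT a mass gap, NOT Clay.  Restate-immune (no Theses import).
-/

set_option autoImplicit false

noncomputable section
namespace Summit.QuantumFields.YangMills.BalabanUVNodes.N15.GenuineRecord

open Literature.MathematicalPhysics.QuantumFieldTheory.Balaban1983to89
open Literature.MathematicalPhysics.QuantumFieldTheory.Balaban1983to89.T4Continuum (T4Family ULoop)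
open Literature.MathematicalPhysics.QuantumFieldTheory.Balaban1983to89.T4EtaRate (PairedInstance NE2PlusOperator NE2PlusSite NE2PlusUnit)
open Node00 (NE2Objects₁₁)
open Summit.QuantumFields.BalabanUV.T4Continuum.HistoryFlow (two_le_L)
open Summit.QuantumFields.YangMills.BalabanUVNodes.N15.AtKeyedHome (s_N15_of_admits neZero_blockFactor)
open YMDAG.UVSplit (Datum NE2Carriers RateCarriers RateRecordPred N15At S_N15 ne2OfRecord₁₁)

variable {d : ℕ} {L : ℕ} [NeZero L]

/-! ## §1 The sized genuine family as N15's `NE2Objects₁₁` literal; `N15At` outright; the three `Live` clauses as theorems -/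

/-- **N15's NE2 OBJECTS OF THE SIZED (GUARD-LIVE) GENUINE `U ≡ 1` FAMILY** (RR-1's layer-A container `Node00.NE2Objects₁₁`): index `TGIndexS` (torus exponent `m_T ≥ 1`, `k ≥ 1`,
scale shift `m`, Bałaban's size `M ≥ 1`), letters `c₃₅`, `p`, the sized realised paired instances `tgInstanceS d hL` (coarse∕fine unit-torus carriers `M_μ = 2L^{m_T}`, King's
pairing, [B9] size field `= M`), OPERATOR kernels `tgFamilyS b ν μ` (the four (3.42) entries of `(Δ′_b⁻¹, Δ_b⁻¹)`), SITE kernel `genuineSiteStepS a_S` (`𝔇((Q′G′²Q′*)⁻¹)` at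
King's couplings on `a_S`), UNIT kernel `tgCovStepS α β` (`𝔇` of [B6] (2.156) `C^{(k)}_Λ` at the unit bonds of directions `α, β`), region `⊤`, unit distance = the carrier's. [bookkeeping] -/
def fullGSizedObjects (d : ℕ) (hL : Odd L ∧ 1 < L) (b aS : ℝ) (ν μ α β : Fin (d + 1)) (c35 p : ℝ) : NE2Objects₁₁ where
  I := TGIndexS
  c35 := c35
  p := p
  pi := tgInstanceS d hL
  Kop := tgFamilyS d hL b ν μ
  Ksite := genuineSiteStepS d hL aS
  Kunit := tgCovStepS d hL α β
  inΛ := fun _ _ => True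
  unitDist := fun j => (tgGeoCS d hL j).dist

/-- The home's NE2 bundle of the objects IS part 82 §5's record (`rfl`, field for field). [bookkeeping] -/
theorem ne2OfRecord₁₁_fullGSizedObjects (hL : Odd L ∧ 1 < L) (b aS : ℝ) (ν μ α β : Fin (d + 1)) (c35 p : ℝ) :
    ne2OfRecord₁₁ (fullGSizedObjects d hL b aS ν μ α β c35 p) =
      { I := TGIndexS, c35 := c35, p := p, pi := tgInstanceS d hL, Kop := tgFamilyS d hL b ν μ, Ksite := genuineSiteStepS d hL aS,
        Kunit := tgCovStepS d hL α β, inΛ := fun _ _ => True, unitDist := fun j => (tgGeoCS d hL j).dist } := rfl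

/-- ★★ **`N15At` AT THE OBJECTS' BUNDLE — OUTRIGHT, EVERY PARAMETER VALUE, SIZE GUARD LIVE** (part 82 `n15At_fullG_sized` read through `ne2OfRecord₁₁`): `d ≥ 1`, odd `L ≥ 3`,
`b, a_S > 0`. [bookkeeping] -/
theorem n15At_fullGSizedObjects (hd : 1 ≤ d) (hLodd : Odd L) (hL2 : 2 ≤ L) (hL : Odd L ∧ 1 < L) {b aS : ℝ} (hb : 0 < b) (haS : 0 < aS)
    (ν μ α β : Fin (d + 1)) (c35 p : ℝ) : N15At (ne2OfRecord₁₁ (fullGSizedObjects d hL b aS ν μ α β c35 p)) :=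
  n15At_fullG_sized (d := d) hd hLodd hL2 hL hb haS ν μ α β c35 p

/-- **THE THREE LAYERS SPELLED OUT at the objects** (`N15At` unfolded: `NE2PlusOperator ∧ NE2PlusSite 4 ∧ NE2PlusUnit`). [bookkeeping] -/
theorem layers_fullGSizedObjects (hd : 1 ≤ d) (hLodd : Odd L) (hL2 : 2 ≤ L) (hL : Odd L ∧ 1 < L) {b aS : ℝ} (hb : 0 < b) (haS : 0 < aS)
    (ν μ α β : Fin (d + 1)) (c35 p : ℝ) :
    NE2PlusOperator c35 (tgInstanceS d hL) (tgFamilyS d hL b ν μ) ∧ NE2PlusSite 4 p c35 (tgInstanceS d hL) (genuineSiteStepS d hL aS) ∧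
      NE2PlusUnit c35 (tgInstanceS d hL) (tgCovStepS d hL α β) (fun _ _ => True) (fun j => (tgGeoCS d hL j).dist) :=
  n15At_fullG_sized (d := d) hd hLodd hL2 hL hb haS ν μ α β c35 p

/-- **RR-1's DISPLAY HOLDS AT THE LITERAL**: the objects are `Populated` (`TGIndexS` carries `(1, 1, 0, 1)`). [bookkeeping] -/
theorem populated_fullGSizedObjects (hL : Odd L ∧ 1 < L) (b aS : ℝ) (ν μ α β : Fin (d + 1)) (c35 p : ℝ) :
    (fullGSizedObjects d hL b aS ν μ α β c35 p).Populated :=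
  (NE2Objects₁₁.populated_iff _).2 tgIndexS_nonempty

/-- ★ **`Live` CLAUSE 1 AT THE BUNDLE — COFINALITY IN THE SIZE AND IN THE NUMBER OF SCALES** (dag-n15-w2's `PairedFamilyGuard.Live.cofinal` field verbatim): for every `M₅`
and `k₀` some index of the bundle has `gf.M ≥ M₅` and `gc.k ≥ k₀` — the guard `M₅ ≤ gf.M` of `NE2PlusOperator`∕`NE2PlusSite` is LIVE on this family (contrast: part 76's
`fullGCovObjects` has `gf.M = 1` at every index and FAILS this). [bookkeeping] -/
theorem cofinal_fullGSizedObjects (hL : Odd L ∧ 1 < L) (b aS : ℝ) (ν μ α β : Fin (d + 1)) (c35 p : ℝ) (M₅ : ℝ) (k₀ : ℕ) :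
    ∃ i : (ne2OfRecord₁₁ (fullGSizedObjects d hL b aS ν μ α β c35 p)).I,
      M₅ ≤ ((ne2OfRecord₁₁ (fullGSizedObjects d hL b aS ν μ α β c35 p)).pi i).gf.M ∧ k₀ ≤ ((ne2OfRecord₁₁ (fullGSizedObjects d hL b aS ν μ α β c35 p)).pi i).gc.k :=
  tgIndexS_cofinal M₅ k₀

/-- ★ **`Live` CLAUSE 2 AT THE BUNDLE — THE TRIVIAL CONFIGURATION IS REGULAR for every `α₀ > 0`** (both (3.35) and (3.36) slots; void on the one-point carrier — said). [bookkeeping] -/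
theorem reg_one_fullGSizedObjects (hL : Odd L ∧ 1 < L) (b aS : ℝ) (ν μ α β : Fin (d + 1)) (c35 p : ℝ)
    (i : (ne2OfRecord₁₁ (fullGSizedObjects d hL b aS ν μ α β c35 p)).I) (α₀ : ℝ) (_hα₀ : 0 < α₀) :
    ((ne2OfRecord₁₁ (fullGSizedObjects d hL b aS ν μ α β c35 p)).pi i).Bf.Reg335 (ne2OfRecord₁₁ (fullGSizedObjects d hL b aS ν μ α β c35 p)).c35 α₀
        ((ne2OfRecord₁₁ (fullGSizedObjects d hL b aS ν μ α β c35 p)).pi i).Bf.one ∧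
      ((ne2OfRecord₁₁ (fullGSizedObjects d hL b aS ν μ α β c35 p)).pi i).Bf.Reg336 (ne2OfRecord₁₁ (fullGSizedObjects d hL b aS ν μ α β c35 p)).c35 α₀
        ((ne2OfRecord₁₁ (fullGSizedObjects d hL b aS ν μ α β c35 p)).pi i).Bf.one :=
  ⟨trivial, trivial⟩

/-- ★ **`Live` CLAUSE 3 AT THE BUNDLE — THE UNIT-LATTICE REGION IS INHABITED at every index** (region `⊤` on an inhabited torus). [bookkeeping] -/
theorem inΛ_nonempty_fullGSizedObjects (hL : Odd L ∧ 1 < L) (b aS : ℝ) (ν μ α β : Fin (d + 1)) (c35 p : ℝ)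
    (i : (ne2OfRecord₁₁ (fullGSizedObjects d hL b aS ν μ α β c35 p)).I) :
    ∃ y, (ne2OfRecord₁₁ (fullGSizedObjects d hL b aS ν μ α β c35 p)).inΛ i y :=
  ⟨fun _ => 0, trivial⟩

/-! ## §2 The keyed-home faces (part 30's stage-generic interface), size guard live -/

section KeyedHome

variable {N : ℕ} [NeZero N] {key : (F : T4Family) → Datum F N → Prop}

/-- ★★ **THE READING CLOSES THE STUB AT ANY KEYED HOME — NO WINDOW, SIZE GUARD LIVE**: for `d ≥ 1`, odd `L ≥ 3`, `b, a_S > 0`, directions `ν μ α β` and letters `c₃₅`, `p`: a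
rate home `RRec` over ANY key that admits only the literals of a key-indexed NE2 reading `ne2At` (`hadm`) whose value everywhere IS `fullGSizedObjects d hL b a_S ν μ α β c₃₅ p`
has `S_N15 RRec` — the estimate is part 82 §5, not a hypothesis. [bookkeeping] -/
theorem s_N15_of_admits_fullGSized (hd : 1 ≤ d) (hLodd : Odd L) (hL2 : 2 ≤ L) (hL : Odd L ∧ 1 < L) {b aS : ℝ} (hb : 0 < b) (haS : 0 < aS)
    (ν μ α β : Fin (d + 1)) (c35 p : ℝ)
    (ne2At : ∀ {F : T4Family} {D : Datum F N}, key F D → (ℕ → ℝ) → List (ULoop F) → ℕ → NE2Objects₁₁) (RRec : RateRecordPred N)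
    (hadm : ∀ (F : T4Family) (D : Datum F N) (g₀ : ℕ → ℝ) (os : List (ULoop F)) (R : RateCarriers N), RRec F D g₀ os R →
      ∃ (h : key F D) (k : ℕ), R.ne2 = ne2OfRecord₁₁ (ne2At h g₀ os k))
    (h : ∀ (F : T4Family) (D : Datum F N) (h : key F D) (g₀ : ℕ → ℝ) (os : List (ULoop F)) (k : ℕ), ne2At h g₀ os k = fullGSizedObjects d hL b aS ν μ α β c35 p) :
    S_N15 RRec := by
  refine s_N15_of_admits ne2At RRec hadm fun F D hk g₀ os k => ?_
  rw [h F D hk g₀ os k]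
  exact n15At_fullGSizedObjects (d := d) hd hLodd hL2 hL hb haS ν μ α β c35 p

/-- `N15At` at the sized genuine literal of a datum family (`(3, F.hL)`; `2 ≤ F.L` from `11 < L`). [bookkeeping] -/
theorem n15At_fullGSizedObjects_family {b aS : ℝ} (hb : 0 < b) (haS : 0 < aS) (ν μ α β : Fin 4) (c35 p : ℝ) (F : T4Family) :
    N15At (ne2OfRecord₁₁ (haveI := neZero_blockFactor F; fullGSizedObjects 3 F.hL b aS ν μ α β c35 p)) := by
  haveI := neZero_blockFactor F
  exact n15At_fullGSizedObjects (d := 3) (by norm_num) F.hL.1 (two_le_L F) F.hL hb haS ν μ α β c35 p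

/-- ★★ **THE FAMILY-KEYED READING CLOSES THE STUB AT ANY KEYED HOME — NO WINDOW, SIZE GUARD LIVE** (`d + 1 = 4`): at a key of family `F` the NE2 objects are the sized genuine
objects on `F`'s OWN block factor (`tgInstanceS 3 F.hL`; Bałaban's `Odd L ∧ 1 < L` IS `F.hL`).  For `b, a_S > 0`, `ν μ α β`, `c₃₅`, `p`: every such reading's home has
`S_N15 RRec` — no estimate and no weight displayed. [bookkeeping] -/
theorem s_N15_of_admits_fullGSized_family {b aS : ℝ} (hb : 0 < b) (haS : 0 < aS) (ν μ α β : Fin 4) (c35 p : ℝ)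
    (ne2At : ∀ {F : T4Family} {D : Datum F N}, key F D → (ℕ → ℝ) → List (ULoop F) → ℕ → NE2Objects₁₁) (RRec : RateRecordPred N)
    (hadm : ∀ (F : T4Family) (D : Datum F N) (g₀ : ℕ → ℝ) (os : List (ULoop F)) (R : RateCarriers N), RRec F D g₀ os R →
      ∃ (h : key F D) (k : ℕ), R.ne2 = ne2OfRecord₁₁ (ne2At h g₀ os k))
    (h : ∀ (F : T4Family) (D : Datum F N) (h : key F D) (g₀ : ℕ → ℝ) (os : List (ULoop F)) (k : ℕ),
      ne2At h g₀ os k = haveI := neZero_blockFactor F; fullGSizedObjects 3 F.hL b aS ν μ α β c35 p) :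
    S_N15 RRec := by
  refine s_N15_of_admits ne2At RRec hadm fun F D hk g₀ os k => ?_
  rw [h F D hk g₀ os k]
  exact n15At_fullGSizedObjects_family hb haS ν μ α β c35 p F

/-- **RR-1's DISPLAY AT THE FAMILY-KEYED LITERAL** (populated at every family). [bookkeeping] -/
theorem populated_fullGSizedObjects_family (F : T4Family) (b aS : ℝ) (ν μ α β : Fin 4) (c35 p : ℝ) :
    (haveI := neZero_blockFactor F; fullGSizedObjects 3 F.hL b aS ν μ α β c35 p).Populated := by
  haveI := neZero_blockFactor F
  exact populated_fullGSizedObjects F.hL b aS ν μ α β c35 p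

/-- **`Live` CLAUSE 1 AT THE FAMILY-KEYED LITERAL** (cofinal in `gf.M` and `gc.k` at every family). [bookkeeping] -/
theorem cofinal_fullGSizedObjects_family (F : T4Family) (b aS : ℝ) (ν μ α β : Fin 4) (c35 p : ℝ) (M₅ : ℝ) (k₀ : ℕ) :
    ∃ i : (ne2OfRecord₁₁ (haveI := neZero_blockFactor F; fullGSizedObjects 3 F.hL b aS ν μ α β c35 p)).I,
      M₅ ≤ ((ne2OfRecord₁₁ (haveI := neZero_blockFactor F; fullGSizedObjects 3 F.hL b aS ν μ α β c35 p)).pi i).gf.M ∧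
        k₀ ≤ ((ne2OfRecord₁₁ (haveI := neZero_blockFactor F; fullGSizedObjects 3 F.hL b aS ν μ α β c35 p)).pi i).gc.k := by
  haveI := neZero_blockFactor F
  exact cofinal_fullGSizedObjects F.hL b aS ν μ α β c35 p M₅ k₀

end KeyedHome

end Summit.QuantumFields.YangMills.BalabanUVNodes.N15.GenuineRecord

/-! ## §3 The Stage-13 v1.7 `CoPH` faces of the sized genuine family (parts 74∕74b∕75 BY NAME) -/

namespace Summit.QuantumFields.YangMills.BalabanUVNodes.N15.AtReadingOfRecord13CoPH

open Literature.MathematicalPhysics.QuantumFieldTheory.Balaban1983to89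
open Literature.MathematicalPhysics.QuantumFieldTheory.Balaban1983to89.T4Continuum (T4Family ULoop)
open Node00 (IsDatumOfRecord₁₃CCoPH Stage13HParams NE2Objects₁₁ NE3Letters₁₁)
open Node00.W1 (ReadingData)
open Summit.QuantumFields.YangMills.BalabanUVNodes.N15.AtKeyedHome (neZero_blockFactor)
open Summit.QuantumFields.YangMills.BalabanUVNodes.N15.AtRRec13CoPH (admits_rRec₁₃CoPH_ne2 s_N15_rRec₁₃CoPHOn_of_pin s_N15_homes₁₃CoPH_of_forall_admissible)
open Summit.QuantumFields.YangMills.BalabanUVNodes.N15.GenuineRecord (fullGSizedObjects n15At_fullGSizedObjects_family s_N15_of_admits_fullGSized_family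
  populated_fullGSizedObjects_family cofinal_fullGSizedObjects_family)
open YMDAG.UVSplit (Datum NE1pCarriers RateCarriers RateRecordPred N15At S_N15 ne2OfRecord₁₁ RateReading₁₃CoPH RRec₁₃CoPH RRec₁₃CoPHOn readingOfRecord₁₃CoPH
  readingOfRecord₁₃CoPH_populated_iff)

variable {N : ℕ} [NeZero N] {b aS : ℝ}

/-- ★ **THE SIZED GENUINE READING CLOSES THE STUB AT THE CANONICAL HOME, NO ESTIMATE, NO WEIGHT, SIZE GUARD LIVE.**  For `b, a_S > 0`, `ν μ α β`, `c₃₅`, `p`: a reading `𝔯`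
whose NE2 objects at every Stage-13 datum key ARE `fullGSizedObjects 3 F.hL b a_S ν μ α β c₃₅ p` has `S_N15 (RRec₁₃CoPH 𝔯)` — part 83 §2 at the certificate
`admits_rRec₁₃CoPH_ne2`. [bookkeeping] -/
theorem s_N15_rRec₁₃CoPH_of_fullGSizedReading (hb : 0 < b) (haS : 0 < aS) (ν μ α β : Fin 4) (c35 p : ℝ) (𝔯 : RateReading₁₃CoPH N)
    (h : ∀ (F : T4Family) (D : Datum F N) (hD : IsDatumOfRecord₁₃CCoPH F N D) (g₀ : ℕ → ℝ) (os : List (ULoop F)) (k : ℕ),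
      (𝔯.lit F hD.params hD.provisos g₀ os).ne2 k = haveI := neZero_blockFactor F; fullGSizedObjects 3 F.hL b aS ν μ α β c35 p) :
    S_N15 (RRec₁₃CoPH 𝔯) :=
  s_N15_of_admits_fullGSized_family (N := N) (key := fun F D => IsDatumOfRecord₁₃CCoPH F N D) hb haS ν μ α β c35 p
    (fun {F D} (hD : IsDatumOfRecord₁₃CCoPH F N D) g₀ os k => (𝔯.lit F hD.params hD.provisos g₀ os).ne2 k) (RRec₁₃CoPH 𝔯) (admits_rRec₁₃CoPH_ne2 𝔯) h

/-- ★ **THE SIZED GENUINE READING CLOSES THE STUB AT EVERY GUARDED HOME** (θ-form on the admissible tuples with provisos in `Rg`; through 74b's `s_N15_rRec₁₃CoPHOn_of_pin`). [bookkeeping] -/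
theorem s_N15_rRec₁₃CoPHOn_of_fullGSizedReading (hb : 0 < b) (haS : 0 < aS) (ν μ α β : Fin 4) (c35 p : ℝ) (𝔯 : RateReading₁₃CoPH N)
    (Rg : (F : T4Family) → Stage13HParams F N → Prop)
    (h : ∀ (F : T4Family) (θ : Stage13HParams F N) (hP : θ.Provisos₁₃CoPH F N), Rg F θ → θ.Admissible F N → ∀ (g₀ : ℕ → ℝ) (os : List (ULoop F)) (k : ℕ),
      (𝔯.lit F θ hP g₀ os).ne2 k = haveI := neZero_blockFactor F; fullGSizedObjects 3 F.hL b aS ν μ α β c35 p) :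
    S_N15 (RRec₁₃CoPHOn 𝔯 Rg) :=
  s_N15_rRec₁₃CoPHOn_of_pin 𝔯 Rg (fun F _ _ _ _ _ => haveI := neZero_blockFactor F; fullGSizedObjects 3 F.hL b aS ν μ α β c35 p) h
    fun F _ _ _ _ _ _ _ => n15At_fullGSizedObjects_family hb haS ν μ α β c35 p F

/-- ★★ **SOME READING CLOSES THE STUB AT BOTH CoPH HOMES OUTRIGHT ON THE SIZED GENUINE OBJECTS — POPULATED AND COFINAL (SIZE GUARD LIVE) EVERYWHERE** [decided,
non-degenerate, no weight]: for `b, a_S > 0`, `ν μ α β`, `c₃₅`, `p` there is a Stage-13 rate reading `𝔯` whose NE2 objects at every tuple ARE `fullGSizedObjects 3 F.hL b a_S ν μ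
α β c₃₅ p`, `Populated` everywhere (RR-1 §8), COFINAL in `gf.M` and `gc.k` everywhere (w2's `Live` clause 1), with `S_N15 (RRec₁₃CoPH 𝔯)` and `S_N15 (RRec₁₃CoPHOn 𝔯 Rg)` for
every `Rg`, NO hypothesis. [bookkeeping] -/
theorem exists_reading_s_N15_rRec₁₃CoPH_fullGSized_family (hb : 0 < b) (haS : 0 < aS) (ν μ α β : Fin 4) (c35 p : ℝ) :
    ∃ 𝔯 : RateReading₁₃CoPH N,
      (∀ (F : T4Family) (θ : Stage13HParams F N) (hP : θ.Provisos₁₃CoPH F N) (g₀ : ℕ → ℝ) (os : List (ULoop F)) (k : ℕ),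
        (𝔯.lit F θ hP g₀ os).ne2 k = haveI := neZero_blockFactor F; fullGSizedObjects 3 F.hL b aS ν μ α β c35 p) ∧
      (∀ (F : T4Family) (θ : Stage13HParams F N) (hP : θ.Provisos₁₃CoPH F N) (g₀ : ℕ → ℝ) (os : List (ULoop F)) (k : ℕ),
        ((𝔯.lit F θ hP g₀ os).ne2 k).Populated) ∧
      (∀ (F : T4Family) (θ : Stage13HParams F N) (hP : θ.Provisos₁₃CoPH F N) (g₀ : ℕ → ℝ) (os : List (ULoop F)) (k : ℕ) (M₅ : ℝ) (k₀ : ℕ),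
        ∃ i : (ne2OfRecord₁₁ ((𝔯.lit F θ hP g₀ os).ne2 k)).I,
          M₅ ≤ ((ne2OfRecord₁₁ ((𝔯.lit F θ hP g₀ os).ne2 k)).pi i).gf.M ∧ k₀ ≤ ((ne2OfRecord₁₁ ((𝔯.lit F θ hP g₀ os).ne2 k)).pi i).gc.k) ∧
      S_N15 (RRec₁₃CoPH 𝔯) ∧ ∀ Rg : (F : T4Family) → Stage13HParams F N → Prop, S_N15 (RRec₁₃CoPHOn 𝔯 Rg) := by
  obtain ⟨r₀⟩ := Node00.nonempty_rateObjects₁₁ (N := N)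
  let lit : (F : T4Family) → (θ : Stage13HParams F N) → θ.Provisos₁₃CoPH F N → (ℕ → ℝ) → List (ULoop F) → Node00.RateObjects₁₁ N :=
    fun F _ _ _ _ => ⟨r₀.u3, r₀.ne3, fun _ => haveI := neZero_blockFactor F; fullGSizedObjects 3 F.hL b aS ν μ α β c35 p⟩
  let 𝔯 : RateReading₁₃CoPH N := ⟨lit, fun _ _ _ _ _ => (⟨Empty, ⟨fun q => q.elim, fun q => q.elim, fun q => q.elim⟩, 0⟩ : NE1pCarriers)⟩
  have h𝔯 : ∀ (F : T4Family) (θ : Stage13HParams F N) (hP : θ.Provisos₁₃CoPH F N) (g₀ : ℕ → ℝ) (os : List (ULoop F)) (k : ℕ),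
      (𝔯.lit F θ hP g₀ os).ne2 k = haveI := neZero_blockFactor F; fullGSizedObjects 3 F.hL b aS ν μ α β c35 p := fun _ _ _ _ _ _ => rfl
  have hS := s_N15_homes₁₃CoPH_of_forall_admissible 𝔯 fun F θ hP _ g₀ os k => by
    rw [h𝔯 F θ hP g₀ os k]
    exact n15At_fullGSizedObjects_family hb haS ν μ α β c35 p F
  refine ⟨𝔯, h𝔯, fun F θ hP g₀ os k => ?_, fun F θ hP g₀ os k M₅ k₀ => ?_, hS.1, hS.2⟩
  · rw [h𝔯 F θ hP g₀ os k]
    exact populated_fullGSizedObjects_family F b aS ν μ α β c35 p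
  · rw [h𝔯 F θ hP g₀ os k]
    exact cofinal_fullGSizedObjects_family F b aS ν μ α β c35 p M₅ k₀

variable (w1 : (F : T4Family) → (θ : Stage13HParams F N) → ReadingData F (Node00.MatA N) θ.τ9.M) (ℓ₃ : T4Family → NE3Letters₁₁)
  (ne2 : (F : T4Family) → Stage13HParams F N → (ℕ → ℝ) → List (ULoop F) → ℕ → NE2Objects₁₁)
  (ne1 : (F : T4Family) → Stage13HParams F N → (ℕ → ℝ) → List (ULoop F) → NE1pCarriers)

/-- ★★ **THE SIZED GENUINE RESIDUAL LAYER CLOSES `h15` AT BOTH HOMES OF THE READING OF RECORD, NO ESTIMATE, NO WEIGHT, SIZE GUARD LIVE**: if on the admissible Stage-13 tuples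
with provisos N15's residual layer `ne2` takes the values `fullGSizedObjects 3 F.hL b a_S ν μ α β c₃₅ p`, then `S_N15` at `RRec₁₃CoPH (readingOfRecord₁₃CoPH w1 ℓ₃ ne2 ne1)` AND at
every `RRec₁₃CoPHOn (…) Rg`; plain `b, a_S > 0`, nothing else. [bookkeeping] -/
theorem s_N15_readingOfRecord₁₃CoPH_homes_of_fullGSized_family (hb : 0 < b) (haS : 0 < aS) (ν μ α β : Fin 4) (c35 p : ℝ)
    (h : ∀ (F : T4Family) (θ : Stage13HParams F N), θ.Provisos₁₃CoPH F N → θ.Admissible F N → ∀ (g₀ : ℕ → ℝ) (os : List (ULoop F)) (k : ℕ),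
      ne2 F θ g₀ os k = haveI := neZero_blockFactor F; fullGSizedObjects 3 F.hL b aS ν μ α β c35 p) :
    S_N15 (RRec₁₃CoPH (readingOfRecord₁₃CoPH w1 ℓ₃ ne2 ne1)) ∧
      ∀ Rg : (F : T4Family) → Stage13HParams F N → Prop, S_N15 (RRec₁₃CoPHOn (readingOfRecord₁₃CoPH w1 ℓ₃ ne2 ne1) Rg) :=
  s_N15_readingOfRecord₁₃CoPH_homes_of_forall w1 ℓ₃ ne2 ne1 fun F θ hP hA g₀ os k => by
    rw [h F θ hP hA g₀ os k]
    exact n15At_fullGSizedObjects_family hb haS ν μ α β c35 p F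

/-- … at the canonical home alone. [bookkeeping] -/
theorem s_N15_readingOfRecord₁₃CoPH_of_fullGSized_family (hb : 0 < b) (haS : 0 < aS) (ν μ α β : Fin 4) (c35 p : ℝ)
    (h : ∀ (F : T4Family) (θ : Stage13HParams F N), θ.Provisos₁₃CoPH F N → θ.Admissible F N → ∀ (g₀ : ℕ → ℝ) (os : List (ULoop F)) (k : ℕ),
      ne2 F θ g₀ os k = haveI := neZero_blockFactor F; fullGSizedObjects 3 F.hL b aS ν μ α β c35 p) :
    S_N15 (RRec₁₃CoPH (readingOfRecord₁₃CoPH w1 ℓ₃ ne2 ne1)) :=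
  (s_N15_readingOfRecord₁₃CoPH_homes_of_fullGSized_family w1 ℓ₃ ne2 ne1 hb haS ν μ α β c35 p h).1

/-- … at the `Rg`-guarded home (every `Rg` at once). [bookkeeping] -/
theorem s_N15_readingOfRecord₁₃CoPHOn_of_fullGSized_family (hb : 0 < b) (haS : 0 < aS) (ν μ α β : Fin 4) (c35 p : ℝ)
    (h : ∀ (F : T4Family) (θ : Stage13HParams F N), θ.Provisos₁₃CoPH F N → θ.Admissible F N → ∀ (g₀ : ℕ → ℝ) (os : List (ULoop F)) (k : ℕ),
      ne2 F θ g₀ os k = haveI := neZero_blockFactor F; fullGSizedObjects 3 F.hL b aS ν μ α β c35 p)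
    (Rg : (F : T4Family) → Stage13HParams F N → Prop) : S_N15 (RRec₁₃CoPHOn (readingOfRecord₁₃CoPH w1 ℓ₃ ne2 ne1) Rg) :=
  (s_N15_readingOfRecord₁₃CoPH_homes_of_fullGSized_family w1 ℓ₃ ne2 ne1 hb haS ν μ α β c35 p h).2 Rg

/-- … such a reading of record is `Populated` at every Stage-13 tuple with provisos. [bookkeeping] -/
theorem populated_readingOfRecord₁₃CoPH_of_fullGSized_family (ν μ α β : Fin 4) (c35 p : ℝ) (F : T4Family) (θ : Stage13HParams F N)
    (hP : θ.Provisos₁₃CoPH F N) (g₀ : ℕ → ℝ) (os : List (ULoop F))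
    (h : ∀ k : ℕ, ne2 F θ g₀ os k = haveI := neZero_blockFactor F; fullGSizedObjects 3 F.hL b aS ν μ α β c35 p) :
    ((readingOfRecord₁₃CoPH w1 ℓ₃ ne2 ne1).lit F θ hP g₀ os).Populated := by
  refine (readingOfRecord₁₃CoPH_populated_iff w1 ℓ₃ ne2 ne1 F θ hP g₀ os).2 fun k => ?_
  rw [h k]
  exact populated_fullGSizedObjects_family F b aS ν μ α β c35 p

-- NOTE (gate `dedup.landed`): the family-free face «∃ ne2, Populated ∧ S_N15 at both homes» is LITERALLY part 77's
-- `exists_ne2_s_N15_readingOfRecord₁₃CoPH_fullGCov` (the statement does not name the objects) — cited, not re-filed; the guard-level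
-- strengthening «∃ ne2, KeyedLive ∧ N15At ∧ Populated ∧ S_N15» is part 84 (S-C) `exists_ne2_keyedLive_s_N15_readingOfRecord₁₃CoPH_fullGSized`.

end Summit.QuantumFields.YangMills.BalabanUVNodes.N15.AtReadingOfRecord13CoPH

end
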